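/-
Copyright (c) 2026. All rights reserved.
Released under Apache 2.0 license as described in the file LICENSE.
-/
import Summits.HodgeConjecture.HodgeConjecture.Theorems.K2LiuArchLadderRungTransfer   -- ★ G6-arch asm FILE 2 p861662 (`ladder`, `rung_transfer`, `anchor`)
import HarnessLib

/-!
# Crux `HLiu418`, G6-arch ASSEMBLY FILE 3: THE LADDER ALONG ELEMENTARY ARROWS `P_{ab}`, `M_{ab}` — the by-value join with ★ S2-T
# (`K2LiuU22KTypeTransitions`: `pOp_{ab} f_{k,l} = (affine in s) • f_{k',l'}`, `mOp_{ab} f_{k,l} = …`) and ★ S2-C (`K2LiuU22KTypePaths`)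

Cell `hodgecm-mathlib`, crux item hLiu418 = `stmt-HodgeConjecture-24832` (helper lane `--supports`, count-neutral).

★ asm FILE 2 `ladder` takes a path of GENERAL block quadruples `(α β γ δ)_i` with the arrow identities for the full operator
`Op^{(k,s)}_{(αβγδ)} = Σ β_{a'b'} P^{(p(s))}_{a'b'} + Σ γ_{a'b'} M^{(q(s))}_{a'b'} + (−k·tr α)·1 − Σ α_{a'b'} L_{a'b'} + Σ δ_{a'b'} R_{a'b'}` (`p(s) = s+1+(−k)∕2`, `q(s) = s+1−(−k)∕2`).
The S2-C paths use ELEMENTARY arrows: `(0, E_{ab}, 0, 0)` (the raising operator `P_{ab}`) and `(0, 0, E_{ab}, 0)` (`M_{ab}`), whose values on the highest-weight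
vectors `f_{k,l} = u₀₀^k D^l` are ★ S2-T.  This file specialises.
* §1 `op_single_p`, `op_single_m` — `Op^{(k,s')}_{(0,E_{ab},0,0)} P = P^{(p(s'))}_{ab} P`, `Op^{(k,s')}_{(0,0,E_{ab},0)} P = M^{(q(s'))}_{ab} P`.
* §2 **`ladder_elementary`** — for a tagged path (`kind i = true`: a `P`-arrow at `(ia i, ib i)`; `false`: an `M`-arrow), scalars `a_i ≠ 0, b_i`, pictures `P_i`
  (`P_0 = D^{−k}`) with `P∕M^{(s)}_{(ia i, ib i)} P_i = a_i • P_{i+1}` and `P∕M^{(−s)}_{(ia i, ib i)} P_i = b_i • P_{i+1}` for `i < n`: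
  `∃ F ∈ I_w(s,χ_k)`, `cp F = P_n`, `cp (M_w(s) F) = (c_k(s)·∏_{i<n} b_i∕a_i) • P_n` (`re s > ½`).  The consumer ((c1) ★ `K2LiuArchLadderMeromorphicPackage`, #41 TOP)
  reads `a_i(s), b_i(s)` off ★ S2-T at its path BY VALUE.
References: [LeeZhu1998, §5 p. 5032, Prop. 5.4]; [Knapp1986, Ch. VIII §3]; [Shimura1982, (1.31)].
HONEST LABEL: HC_CM is proved only modulo the 7 printed citations (2 remaining named inputs: hLiu418 = stmt-HodgeConjecture-24832,
h413 = stmt-HodgeConjecture-24833) until rung 0 closes; count-neutral helper, closes no socket.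
-/

set_option autoImplicit false
set_option linter.dupNamespace false

noncomputable section

open Complex Matrix MeasureTheory NormedSpace
open scoped ComplexConjugate ComplexOrder

namespace Summit.HodgeConjecture.HodgeConjecture.Cruxes.HLiu418.K2LiuArchLadderElementaryArrows

open Summit.HodgeConjecture.HodgeConjecture.Cruxes.HLiu418.K2LiuArchInducedTubeDefs
open Summit.HodgeConjecture.HodgeConjecture.Cruxes.HLiu418.K2LiuU22CompactPictureDefs
open Summit.HodgeConjecture.HodgeConjecture.Cruxes.HLiu418.K2LiuU22CompactPictureOperatorDictionary
open Summit.HodgeConjecture.HodgeConjecture.Cruxes.HLiu418.K2LiuArchNormalisingScalar (archScalarCoeff)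
open Summit.HodgeConjecture.HodgeConjecture.Cruxes.HLiu418.K2LiuArchLadderRungTransfer (ladder)

/-! ## §1  Elementary quadruples -/

/-- `Op^{(k,s')}_{(0, E_{ab}, 0, 0)} P = P^{(s'+1+(−k)∕2)}_{ab} P`. [LeeZhu1998, §5] -/
theorem op_single_p (k : ℤ) (s' : ℂ) (a b : Fin 2) (P : Carrier) :
    (∑ a' : Fin 2, ∑ b' : Fin 2, (Matrix.single a b (1 : ℂ)) a' b' • pOp pd uMat dInv (s' + 1 + (-(k : ℂ)) / 2) a' b' P +
          ∑ a' : Fin 2, ∑ b' : Fin 2, (0 : Matrix (Fin 2) (Fin 2) ℂ) a' b' • mOp pd uMat (s' + 1 - (-(k : ℂ)) / 2) a' b' P + ((-(k : ℂ)) * ((0 : Matrix (Fin 2) (Fin 2) ℂ)).trace) • P -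
          ∑ a' : Fin 2, ∑ b' : Fin 2, (0 : Matrix (Fin 2) (Fin 2) ℂ) a' b' • lOp pd uMat a' b' P + ∑ a' : Fin 2, ∑ b' : Fin 2, (0 : Matrix (Fin 2) (Fin 2) ℂ) a' b' • rOp pd uMat a' b' P) =
      pOp pd uMat dInv (s' + 1 + (-(k : ℂ)) / 2) a b P := by
  fin_cases a <;> fin_cases b <;>
    simp [Matrix.single_apply, Fin.sum_univ_two, Matrix.zero_apply, Matrix.trace_zero]

/-- `Op^{(k,s')}_{(0, 0, E_{ab}, 0)} P = M^{(s'+1−(−k)∕2)}_{ab} P`. [LeeZhu1998, §5] -/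
theorem op_single_m (k : ℤ) (s' : ℂ) (a b : Fin 2) (P : Carrier) :
    (∑ a' : Fin 2, ∑ b' : Fin 2, (0 : Matrix (Fin 2) (Fin 2) ℂ) a' b' • pOp pd uMat dInv (s' + 1 + (-(k : ℂ)) / 2) a' b' P +
          ∑ a' : Fin 2, ∑ b' : Fin 2, (Matrix.single a b (1 : ℂ)) a' b' • mOp pd uMat (s' + 1 - (-(k : ℂ)) / 2) a' b' P + ((-(k : ℂ)) * ((0 : Matrix (Fin 2) (Fin 2) ℂ)).trace) • P -
          ∑ a' : Fin 2, ∑ b' : Fin 2, (0 : Matrix (Fin 2) (Fin 2) ℂ) a' b' • lOp pd uMat a' b' P + ∑ a' : Fin 2, ∑ b' : Fin 2, (0 : Matrix (Fin 2) (Fin 2) ℂ) a' b' • rOp pd uMat a' b' P) =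
      mOp pd uMat (s' + 1 - (-(k : ℂ)) / 2) a b P := by
  fin_cases a <;> fin_cases b <;>
    simp [Matrix.single_apply, Fin.sum_univ_two, Matrix.zero_apply, Matrix.trace_zero]

/-! ## §2  The ladder along a tagged elementary path -/

/-- **THE LADDER ALONG ELEMENTARY ARROWS** (`re s > ½`).  A tagged path: at step `i`, a `P`-arrow (`kind i = true`) or an `M`-arrow (`kind i = false`) at matrix
position `(ia i, ib i)`; scalars `a_i ≠ 0` (source, parameter `s`) and `b_i` (target, parameter `−s`); pictures `P_i` with `P_0 = D^{−k}` and the two arrow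
identities for `i < n` (★ S2-T on `f_{k,l}` by value).  THEN `∃ F ∈ I_w(s,χ_k)` with `cp F = P_n` and `cp (M_w(s) F) = (c_k(s)·∏_{i<n} b_i∕a_i) • P_n`.
★ asm FILE 2 `ladder` at the quadruples `(0, E, 0, 0)` ∕ `(0, 0, E, 0)` via §1. [LeeZhu1998, §5 p. 5032, Prop. 5.4] [Shimura1982, (1.31)] -/
theorem ladder_elementary (k : ℤ) {s : ℂ} (hs : 1 / 2 < s.re) (kind : ℕ → Bool) (ia ib : ℕ → Fin 2) (a b : ℕ → ℂ) (P : ℕ → Carrier)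
    (hP0 : P 0 = dz (-k)) (n : ℕ) (ha : ∀ i < n, a i ≠ 0)
    (hsrc : ∀ i < n, (if kind i = true then pOp pd uMat dInv (s + 1 + (-(k : ℂ)) / 2) (ia i) (ib i) (P i)
      else mOp pd uMat (s + 1 - (-(k : ℂ)) / 2) (ia i) (ib i) (P i)) = a i • P (i + 1))
    (htgt : ∀ i < n, (if kind i = true then pOp pd uMat dInv (-s + 1 + (-(k : ℂ)) / 2) (ia i) (ib i) (P i)
      else mOp pd uMat (-s + 1 - (-(k : ℂ)) / 2) (ia i) (ib i) (P i)) = b i • P (i + 1)) :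
    ∃ F : Matrix (Fin 2 ⊕ Fin 2) (Fin 2 ⊕ Fin 2) ℂ → ℂ, IsArchSiegelSection (fun z : ℂ => (conj z / ((‖z‖ : ℝ) : ℂ)) ^ k) s F ∧
      (∀ (v : Matrix (Fin 2) (Fin 2) ℂ), vᴴ * v = 1 → ∀ hv : v.det ≠ 0, F ((2 : ℂ)⁻¹ • fromBlocks (1 + v) (-(I • (1 - v))) (I • (1 - v)) (1 + v) : Matrix (Fin 2 ⊕ Fin 2) (Fin 2 ⊕ Fin 2) ℂ) = evalAt v hv (P n)) ∧
      (∀ (u : Matrix (Fin 2) (Fin 2) ℂ), uᴴ * u = 1 → ∀ hu' : u.det ≠ 0,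
        archIntertwining F ((2 : ℂ)⁻¹ • fromBlocks (1 + u) (-(I • (1 - u))) (I • (1 - u)) (1 + u) : Matrix (Fin 2 ⊕ Fin 2) (Fin 2 ⊕ Fin 2) ℂ) = evalAt u hu' ((archScalarCoeff k s * ∏ i ∈ Finset.range n, b i / a i) • P n)) := by
  refine ladder k hs (fun _ => (0 : Matrix (Fin 2) (Fin 2) ℂ)) (fun i => if kind i = true then Matrix.single (ia i) (ib i) (1 : ℂ) else (0 : Matrix (Fin 2) (Fin 2) ℂ))
    (fun i => if kind i = true then (0 : Matrix (Fin 2) (Fin 2) ℂ) else Matrix.single (ia i) (ib i) (1 : ℂ)) (fun _ => (0 : Matrix (Fin 2) (Fin 2) ℂ)) a b P hP0 n ha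
    (fun i hi => ?_) (fun i hi => ?_)
  · have h := hsrc i hi
    by_cases hk : kind i = true
    · simp only [if_pos hk] at h ⊢
      rwa [op_single_p]
    · simp only [if_neg hk] at h ⊢
      rwa [op_single_m]
  · have h := htgt i hi
    by_cases hk : kind i = true
    · simp only [if_pos hk] at h ⊢
      rwa [op_single_p]
    · simp only [if_neg hk] at h ⊢
      rwa [op_single_m]

end Summit.HodgeConjecture.HodgeConjecture.Cruxes.HLiu418.K2LiuArchLadderElementaryArrows

end
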